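import Summits.CriticalPhenomena.PercolationContinuityZ3.Theorems.PercNearOneGluingNoHeavyQuantSGCTopLowCapacity
import Summits.CriticalPhenomena.PercolationContinuityZ3.Theorems.PercNearOneGluingNoHeavyQuantSDEC
import HarnessLib

/-!
# QUANT lane R8, the GRADED-CLOSURE programme for the light half (lead g37 RULING V364), part 1: the DEPTH-≤1 row family `LawDec.TLC`
# (all top-low-capacity rows of a law) and its place between DEC and the two-layer bounds

builds on p205010 (kernel theorem, internal audit signed; external expert review pending)

Support file (`--supports stmt-CriticalPhenomena-4575`), QUANT lane seat prim-quant-census-2 (gen 64), rung R8 of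
`run/shared/lean/prim/quant/LADDER.md`; lane INBOX 2026-08-24 l.1366 (RULING V364: "census-2 types the {TLB, TLCR} interface + vertex census;
arm-2 proves").  One `Prop` definition with parameters (`LawDec.TLC`), theorems with standard axioms, no sorries.  Part 2 (`…QuantDepthOneClosure`,
same seat) adds the bridge to `LawDec.TLB` of `…QuantTLBClosure` and the typed node G₀; it is a separate file only because `…QuantTLBClosure`'s olean
is not yet built on the farm at the time of writing.  Census memo: `run/shared/lean/prim/quant/prim-quant-census-2-g64/G0-CENSUS-G64.md`.

THE INTERFACE.  For a law `ν` on `{0..M}` (in the applications the GATED law, phantom zero included), a target `τ` and a floor `0 < y < 1`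
(`u = y/(1−y)`):
* depth 0 = the two-layer bounds (`LawDec.TLB u τ M ν` of `…QuantTLBClosure`, lead g37; `LawDec.TwoLayer` of `…QuantTwoLayerClosure`, arm-2 g38):
  `u·ν{≤ d} ≤ ν{≥ τ − d}` for every integer `d` with `2d < τ`;
* depth ≤ 1 = **`LawDec.TLC y τ M ν`** (this file): for every layer `j < M` and threshold `i′ ≤ j` with `2i′ < τ`, the TOP-LOW-CAPACITY row TLCR(j, i′)
  `u·ν{≤ i′} ≤ ν{> j} + u·Σ_{h ≤ j, τ < i′ + h} ν(h) / usage y τ j i′ h`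
  — the lows up to `i′` fit into the giants of layer `j` plus the mids compatible with `i′`, each at least at the rate of `i′` (census-2 g63
  NP-STEP-G63 §4 (B); `LawDec.usage` of `…QuantLawDecFlows`; the row is literally the conclusion of `IsFlowAtT.lowMass_le_giants_add_midCapacity`).
KERNEL FACTS.  (1) a law with a flow witness at every layer `j < M` — equivalently DEC at every such layer (`…QuantLawDecFlows`) — satisfies `TLC` at its
mean: `tlc_of_flowAtT`, `tlc_of_decAt_all`, and in the binder of `LawDec.SingleGateConvClosed` the gated factor does: `tlc_gate_of_decAt_all`;
(2) **`TLC` CONTAINS DEPTH 0**: `twoLayerRow_of_tlc` — for `τ ≤ M` and `2d < τ`, the row at layer `j = ⌈τ − d⌉ − 1 < M`, threshold `i′ = d` has no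
compatible mid (`h ≤ j < τ − d`) and its giants `h ≥ ⌈τ − d⌉` are exactly the atoms with `τ − d ≤ h`, so it IS the two-layer bound at `d` (the body of
`LawDec.TLB`, spelled out here; part 2 restates it as `TLB (y/(1−y)) τ M ν`).  So the hypothesis side of the node G₀ ("TA + mean + TLB + TLC of both
gated factors ⟹ TLB of the gated convolution", part 2) is one family, `TLC`, and it sits between DEC and TLB:  DEC(all `j < M`) ⟹ TLC ⟹ TLB.

WHY THE FAMILY IS THE RIGHT SIZE (census-2 g64, exact; memo §2–§4): the product's two-layer bounds do NOT follow from the factors' two-layer bounds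
(`not_tlbGateConvClosed`, `M = 9`), nor does TLC of the product follow from TLC of the factors (depth-1 closure false at `M = 14`: kit j214518, first
failure `y = 47/100`, partner `{0: 53/100, 2: 47/100}`, margin `9.52·10⁻⁶`; the lead's `M = 15` at `y = .4344` reproduced to the digit, `1.5058·10⁻⁵`),
but TLC of the factors ⟹ TLB of the product has NO exact counterexample in ≈ 370 000 certified LPs (free full-support factor `M₁ ≤ 40`, eleven admissible
partners, light / near-half / heavy floors, all gates; kit j214516 j214517 j214519 j214520 on item stmt-CriticalPhenomena-4575), worst margin EXACTLY `0`.
VERTEX CENSUS (kit j214664): the exact depth-1 polytope {mass, mean, TLB, TLC} on the full support `{0..M}`, `M ≤ 10`, 16 light `(q, y)` cells × 7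
means: 15 815 enumerated vertices, at most **4** atoms (`M ≤ 7`: 3); 17.5 M vertex-pair × row tests of G₀: 0 violations.  HONEST STATUS: nothing here
changes the lane's RATE class log\* or honest sentence (`run/shared/lean/prim/quant/README.md`); G₀ itself (part 2) is OPEN.

[this work]; TLCR rows and their necessity: prim-quant-census-2 g63 (`…QuantSGCTopLowCapacity`); two-layer bounds / the refuted depth-0 node:
prim-quant-lead g37 (`…QuantTLBClosure`), prim-quant-arm-2 g34/g38; flows and usage: prim-quant-stmt g22 (this lane).  Nothing here is cited as a
published result.  The gluing rows served [cite: KozmaNitzan2024, Conjecture 3 (p. 15)]; product measure [cite: Grimmett1999, §1.3 p. 10].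
-/

noncomputable section

namespace Summit.CriticalPhenomena.PercolationContinuityZ3.Theorems

namespace Quant

open Finset

namespace LawDec

/-! ### The depth-≤1 family: all top-low-capacity rows -/

/-- **THE DEPTH-≤1 ROW FAMILY `TLC y τ M ν`** (all top-low-capacity rows TLCR(j, i′) of census-2 g63): for every layer `j < M` and every
threshold `i′ ≤ j` with `2i′ < τ`,
`y/(1−y)·Σ_{l ≤ i′} ν l ≤ Σ_{h ≤ M, h > j} ν h + y/(1−y)·Σ_{h ≤ M, h ≤ j, τ < i′+h} ν h / usage y τ j i′ h`
— the lows up to `i′` can only use the giants of layer `j` (rate `y/(1−y)`) and the mids `h ≤ j` compatible with `i′`, each at a rate at least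
`usage(i′, h)`.  Rows with `i′ + j < τ` have no compatible mid and are two-layer bounds; layers `j ≥ M` are omitted (there DEC is Theorem A).
The shape is literally the conclusion of `IsFlowAtT.lowMass_le_giants_add_midCapacity`. [this work] -/
def TLC (y τ : ℝ) (M : ℕ) (ν : ℕ → ℝ) : Prop :=
  ∀ j i' : ℕ, j < M → i' ≤ j → 2 * (i' : ℝ) < τ →
    y / (1 - y) * ∑ l ∈ Finset.range (i' + 1), ν l
      ≤ ∑ h ∈ Finset.range (M + 1), (if j + 1 ≤ h then ν h else 0)
        + y / (1 - y) * ∑ h ∈ Finset.range (M + 1),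
            (if h ≤ j ∧ τ < (i' : ℝ) + h then ν h / usage y τ j i' h else 0)

/-! ### DEC ⟹ TLC -/

/-- **a flow witness at every layer below the top gives `TLC`** (`0 < y < 1`): row `(j, i′)` is
`IsFlowAtT.lowMass_le_giants_add_midCapacity` for the layer-`j` witness. [this work] -/
theorem tlc_of_flowAtT {y τ : ℝ} {M : ℕ} {ν : ℕ → ℝ} (hy0 : 0 < y) (hy1 : y < 1)
    (hF : ∀ j, j < M → FlowAtT y τ j M ν) : TLC y τ M ν := by
  intro j i' hj hi' hlow
  obtain ⟨f, hf⟩ := (flowAtT_iff_exists_isFlowAtT y τ j M ν).1 (hF j hj)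
  exact hf.lowMass_le_giants_add_midCapacity hy0 hy1 i' hi' hlow

/-- **DEC at every layer below the top gives `TLC` at the mean** (`0 < y < 1`), through the flow normal form
`flowAtT_of_decAtT`. [this work] -/
theorem tlc_of_decAt_all {y : ℝ} {M : ℕ} {ν : ℕ → ℝ} (hy0 : 0 < y) (hy1 : y < 1)
    (hdec : ∀ j, j < M → DECAt y j M ν) :
    TLC y (∑ h ∈ Finset.range (M + 1), (h : ℝ) * ν h) M ν :=
  tlc_of_flowAtT hy0 hy1 fun j hj =>
    flowAtT_of_decAtT y _ j M ν hy0 hy1 ((decAt_iff_decAtT y j M ν).1 (hdec j hj))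

/-- **in the binder of `LawDec.SingleGateConvClosed` the gated factor satisfies `TLC`** at floor `y`, target `q·T`:
DEC of `gate μ q` at every layer `j < M` (its mean is `q·T`, `sum_mul_gate`). [this work] -/
theorem tlc_gate_of_decAt_all {y q : ℝ} {M : ℕ} {μ : ℕ → ℝ} (hy0 : 0 < y) (hy1 : y < 1)
    (hdec : ∀ j, j < M → DECAt y j M (gate μ q)) :
    TLC y (q * ∑ h ∈ Finset.range (M + 1), (h : ℝ) * μ h) M (gate μ q) := by
  rw [← sum_mul_gate]
  exact tlc_of_decAt_all hy0 hy1 hdec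

/-! ### TLC contains depth 0 -/

/-- **`TLC` CONTAINS DEPTH 0: the top-low-capacity rows imply every two-layer bound** (`τ ≤ M`).  For `2d < τ` read the row at the layer
`j = ⌈τ − d⌉ − 1` (`< M`) and threshold `i′ = d` (`≤ j` iff `2d < τ`): no mid `h ≤ j < τ − d` is compatible with `d`, and the giants
`h ≥ ⌈τ − d⌉` are exactly the atoms with `τ − d ≤ h`.  The conclusion is the body of `LawDec.TLB (y/(1−y)) τ M ν` at `d`
(`…QuantTLBClosure`; restated there-wards in part 2 as `tlb_of_tlc`). [this work] -/
theorem twoLayerRow_of_tlc {y τ : ℝ} {M : ℕ} {ν : ℕ → ℝ} (hτM : τ ≤ (M : ℝ)) (h : TLC y τ M ν) (d : ℕ)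
    (hd : 2 * (d : ℝ) < τ) :
    y / (1 - y) * ∑ h ∈ Finset.range (d + 1), ν h
      ≤ ∑ h ∈ Finset.range (M + 1), (if τ - d ≤ (h : ℝ) then ν h else 0) := by
  have hd0 : (0 : ℝ) ≤ d := Nat.cast_nonneg d
  have hpos : (0 : ℝ) < τ - d := by linarith
  set c : ℕ := ⌈τ - (d : ℝ)⌉₊ with hc
  have hcge : τ - d ≤ (c : ℝ) := Nat.le_ceil _
  have hclt : (c : ℝ) < τ - d + 1 := Nat.ceil_lt_add_one hpos.le
  have hc1 : 1 ≤ c := by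
    by_contra h0
    have h00 : c = 0 := by omega
    rw [h00, Nat.cast_zero] at hcge
    linarith
  have hdc : d < c := by
    have : (d : ℝ) < c := by linarith
    exact_mod_cast this
  have hcM : c ≤ M := by
    have h1 : (c : ℝ) < (M : ℝ) + 1 := by linarith
    have h2 : c < M + 1 := by exact_mod_cast h1
    omega
  have row := h (c - 1) d (by omega) (by omega) hd
  -- no compatible mid below the layer `c - 1`
  have hmid : ∑ k ∈ Finset.range (M + 1),
      (if k ≤ c - 1 ∧ τ < (d : ℝ) + k then ν k / usage y τ (c - 1) d k else 0) = 0 := by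
    refine Finset.sum_eq_zero fun k _ => ?_
    rw [if_neg]
    rintro ⟨h1, h2⟩
    have h3 : k + 1 ≤ c := by omega
    have h4 : ((k + 1 : ℕ) : ℝ) ≤ c := by exact_mod_cast h3
    push_cast at h4
    linarith
  rw [hmid, mul_zero, add_zero] at row
  -- the giants of layer `c - 1` are the atoms `h ≥ τ - d`
  have hgi : ∑ k ∈ Finset.range (M + 1), (if c - 1 + 1 ≤ k then ν k else 0)
      = ∑ k ∈ Finset.range (M + 1), (if τ - d ≤ (k : ℝ) then ν k else 0) := by
    refine Finset.sum_congr rfl fun k _ => ?_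
    have hc' : c - 1 + 1 = c := by omega
    rw [hc']
    by_cases hk : c ≤ k
    · have : (c : ℝ) ≤ k := by exact_mod_cast hk
      rw [if_pos hk, if_pos (by linarith)]
    · rw [if_neg hk, if_neg (fun hle => hk (Nat.ceil_le.2 hle))]
  rw [hgi] at row
  exact row

/-- the mean of a probability law on `{0..M}` is at most `M`. [this work] -/
theorem sum_mul_le_top (M : ℕ) (μ : ℕ → ℝ) (hμ0 : ∀ h, 0 ≤ μ h) (hμ1 : ∑ h ∈ Finset.range (M + 1), μ h = 1) :
    ∑ h ∈ Finset.range (M + 1), (h : ℝ) * μ h ≤ (M : ℝ) := by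
  calc ∑ h ∈ Finset.range (M + 1), (h : ℝ) * μ h ≤ ∑ h ∈ Finset.range (M + 1), (M : ℝ) * μ h := by
        refine Finset.sum_le_sum fun h hh => ?_
        rw [Finset.mem_range] at hh
        have : (h : ℝ) ≤ M := by exact_mod_cast Nat.lt_succ_iff.1 hh
        exact mul_le_mul_of_nonneg_right this (hμ0 h)
    _ = (M : ℝ) := by rw [← Finset.mul_sum, hμ1, mul_one]

/-- **the gated target is below the top**: `0 ≤ q ≤ 1`, `μ` a probability law on `{0..M}` ⟹ `q·T ≤ M` (the side condition of
`twoLayerRow_of_tlc` in every binder of the lane). [this work] -/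
theorem gate_target_le_top {q : ℝ} {M : ℕ} {μ : ℕ → ℝ} (hq0 : 0 ≤ q) (hq1 : q ≤ 1)
    (hμ0 : ∀ h, 0 ≤ μ h) (hμ1 : ∑ h ∈ Finset.range (M + 1), μ h = 1) :
    q * ∑ h ∈ Finset.range (M + 1), (h : ℝ) * μ h ≤ (M : ℝ) := by
  have hT := sum_mul_le_top M μ hμ0 hμ1
  have hT0 : 0 ≤ ∑ h ∈ Finset.range (M + 1), (h : ℝ) * μ h :=
    Finset.sum_nonneg fun h _ => mul_nonneg (Nat.cast_nonneg h) (hμ0 h)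
  nlinarith

end LawDec

end Quant

end Summit.CriticalPhenomena.PercolationContinuityZ3.Theorems
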